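import Literature.NumberTheory.Sieve.RomanovConstantPintzMethod
import Literature.NumberTheory.Sieve.ParityWave0Proofs
import HarnessLib

/-!
# The first moment of the representation function of `p + 2^k` (Pintz 2006, Prop. 2): `Σ_{n ≤ N} r(n) ∼ N/log 2` —
# the lower half `S₁(N) ≥ (1/log 2 − ε)N` PROVED from the tree's prime number theorem, and the `hS1` row of the tree's
# Romanov frames discharged

Topic `Literature/NumberTheory/Sieve` (Romanov's constant); sequel to `RomanovConstantPintzMethod.lean`, whose typed
deductions `eventually_card_romanovSet_ge` (Pintz's Lemma 4′ method), `eventually_card_romanovSet_ge_cs` (Cauchy–Schwarz)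
and `goldbach_linnik_two_of_moments` (Pintz's "`K = 2`" observation) take, for an ARBITRARY representation function `r`
supported on Romanov's set, two analytic rows as hypotheses: the first moment `hS1 : S₁(N) = Σ_{n ≤ N} r(n) ≥ (1/log 2 − ε)N`
and the second moment `hS2 : S₂(N) ≤ (D/log 2 + ε)N`.  For THE representation function of the literature,
`r(n) = #{(p, k) : p prime, k ≥ 1, p + 2^k = n}` (Pintz 2006 / Johnston–Trudgian §4.1 `r(n) = #{(p, a) : n = p + 2^a}`;
Habsieger–Roblot's `r(n) = #{(p,k) : n = p + 2^k, p ≤ N, 1 ≤ k ≤ L}` agrees for `n ≤ N`), the first row is the prime number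
theorem summed over `k`: "`S₁(N) ∼ N/log 2`" [JohnstonTrudgian2026 v2 §4.1], Pintz's Prop. 2 [Pintz2006] — and the prime
number theorem is a THEOREM OF THIS TREE (`Literature.NumberTheory.Sieve.tendsto_primeCounting_mul_log_div`,
`ParityWave0Proofs`, Montgomery–Vaughan (8.1)).  This file proves the lower half of Prop. 2 for this `r` (which is all the
frames use) and re-issues the three frames with `hS1` DISCHARGED: only the sieve row `hS2` (Pintz's Lemma 3′: upper-bound
sieve for prime pairs + Romanov's series, `D = 1 + C₀C₁R₀/log 2`) remains a hypothesis.  PUBLISHED RESULT, REPRODUCED;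
nothing here is new mathematics; harness cell `pub-lg7` (reproduce-first audit; THIS IS NOT A ROUTE TO GOLDBACH), Romanov
table (COMPARATORS §3 / §29).

* §1 `romanovRep n` and its support (`romanovRep_pos_iff` — the frames' `hr`), the first moment as a pair count
  (`card_pairs_le_sum_romanovRep`: `Σ_{n ≤ N} r(n) ≥ K · π(N − 2^K)` whenever `2^K ≤ N`).
* §2 **Pintz 2006 Prop. 2, lower half** `pintz2006_prop2_lower : ∀ ε > 0, ∀ᶠ N, (1/log 2 − ε)N ≤ Σ_{n ≤ N} r(n)`: take
  `K = ⌊log₂N⌋ − T` with `2^{-T}` small, so that `K ≥ log N/log 2 − (T + 1)` and `N − 2^K ≥ (1 − 2^{-T})N`, and the prime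
  number theorem at `N − 2^K`.
* §3 the frames with `hS1` discharged: `eventually_card_romanovSet_ge_of_secondMoment` (Pintz's value
  `(2k + 1 − D)/(k(k+1) log 2)`), `eventually_card_romanovSet_ge_cs_of_secondMoment` (`1/(D log 2)`),
  `goldbach_linnik_two_of_secondMoment`.

## References

* J. Pintz, *A note on Romanov's constant*, Acta Math. Hungar. 112 (2006) 1–14: Prop. 2 (`S₁(N) ∼ N/log 2`), Lemma 3′, Lemma
  4′ (not held; quoted through Johnston–Trudgian v2 §4.1). [Pintz2006]
* D. R. Johnston, T. Trudgian, *An update on the Linnik–Goldbach problem*, arXiv:2605.17825v2 (2026), §4.1 ("`r(n)` … the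
  number of pairs `(p, a)` with `n = p + 2^a` … `S₁(N) ∼ N/log 2`"). [JohnstonTrudgian2026]
* H. L. Montgomery, R. C. Vaughan, *Multiplicative Number Theory I*, CUP 2007, (8.1) (prime number theorem) — through the
  tree theorem `tendsto_primeCounting_mul_log_div`. [MontgomeryVaughan2007]
-/

noncomputable section

namespace Literature.NumberTheory.Sieve

namespace RomanovConstant

open Finset Filter Romanov

/-! ### §1 The representation function and the first moment as a pair count -/

/-- `r(n) = #{(p, k) : p prime, k ≥ 1, p + 2^k = n}` — the representation function of the Romanov problem (Pintz 2006;
Johnston–Trudgian §4.1 "the number of pairs `(p, a)` with `n = p + 2^a`"; here `k ≥ 1` as in the tree's `romanovSet`).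
Both coordinates are `≤ n`, so the pairs are taken from `[0, n]²`. [cite: Pintz2006, Prop. 2] [cite: JohnstonTrudgian2026, v2 §4.1] -/
def romanovRep (n : ℕ) : ℕ :=
  (((Finset.range (n + 1)) ×ˢ (Finset.range (n + 1))).filter
    (fun x : ℕ × ℕ => x.1.Prime ∧ 1 ≤ x.2 ∧ x.1 + 2 ^ x.2 = n)).card

/-- A representation `n = p + 2^k` has `p ≤ n` and `k ≤ n`. [folklore] -/
private theorem bounds_of_rep {p k n : ℕ} (h : p + 2 ^ k = n) : p < n + 1 ∧ k < n + 1 := by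
  have hk : k < 2 ^ k := Nat.lt_two_pow_self
  omega

/-- `r(n) > 0 ↔ n = p + 2^k` for some prime `p` and `k ≥ 1` — the support hypothesis `hr` of the tree's Romanov frames.
[cite: Pintz2006, Prop. 2] -/
theorem romanovRep_pos_iff (n : ℕ) : 0 < romanovRep n ↔ ∃ p k : ℕ, p.Prime ∧ 1 ≤ k ∧ p + 2 ^ k = n := by
  rw [romanovRep, Finset.card_pos]
  constructor
  · rintro ⟨⟨p, k⟩, hx⟩
    rw [Finset.mem_filter] at hx
    exact ⟨p, k, hx.2.1, hx.2.2.1, hx.2.2.2⟩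
  · rintro ⟨p, k, hp, hk, hpk⟩
    refine ⟨(p, k), ?_⟩
    rw [Finset.mem_filter, Finset.mem_product, Finset.mem_range, Finset.mem_range]
    exact ⟨⟨(bounds_of_rep hpk).1, (bounds_of_rep hpk).2⟩, hp, hk, hpk⟩

/-- The pairs `(p, k)` with `p ≤ N − 2^K` prime and `1 ≤ k ≤ K`. [folklore] -/
private def lowPairs (N K : ℕ) : Finset (ℕ × ℕ) := Nat.primesLE (N - 2 ^ K) ×ˢ Finset.Icc 1 K

/-- **The first moment counts pairs**: if `2^K ≤ N` then `Σ_{n ≤ N} r(n) ≥ K · π(N − 2^K)` (every pair `(p, k)` with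
`p ≤ N − 2^K`, `k ≤ K` gives `p + 2^k ≤ N` and is counted once, in `r(p + 2^k)`).
[cite: Pintz2006, Prop. 2 (proof: summation of the prime number theorem over `k`)] -/
theorem card_pairs_le_sum_romanovRep {N K : ℕ} (hK : 2 ^ K ≤ N) :
    (K : ℝ) * Nat.primeCounting (N - 2 ^ K) ≤ ∑ n ∈ Finset.range (N + 1), (romanovRep n : ℝ) := by
  classical
  -- the pair set maps into `[0, N]` by `(p, k) ↦ p + 2^k`
  have hmap : ∀ x ∈ lowPairs N K, x.1 + 2 ^ x.2 ∈ Finset.range (N + 1) := by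
    intro x hx
    rw [lowPairs, Finset.mem_product, Nat.primesLE_eq_filter_range, Finset.mem_filter, Finset.mem_range,
      Finset.mem_Icc] at hx
    rw [Finset.mem_range]
    have h2 : 2 ^ x.2 ≤ 2 ^ K := Nat.pow_le_pow_right (by norm_num) hx.2.2
    omega
  have hcard : (lowPairs N K).card = ∑ n ∈ Finset.range (N + 1),
      ((lowPairs N K).filter (fun x => x.1 + 2 ^ x.2 = n)).card :=
    Finset.card_eq_sum_card_fiberwise hmap
  -- each fibre is contained in the set counted by `r(n)`
  have hfib : ∀ n ∈ Finset.range (N + 1),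
      ((lowPairs N K).filter (fun x => x.1 + 2 ^ x.2 = n)).card ≤ romanovRep n := by
    intro n _
    apply Finset.card_le_card
    intro x hx
    rw [Finset.mem_filter, lowPairs, Finset.mem_product, Nat.primesLE_eq_filter_range, Finset.mem_filter,
      Finset.mem_Icc] at hx
    rw [Finset.mem_filter, Finset.mem_product, Finset.mem_range, Finset.mem_range]
    exact ⟨⟨(bounds_of_rep hx.2).1, (bounds_of_rep hx.2).2⟩, hx.1.1.2, hx.1.2.1, hx.2⟩
  have hsum : (lowPairs N K).card ≤ ∑ n ∈ Finset.range (N + 1), romanovRep n := by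
    rw [hcard]; exact Finset.sum_le_sum hfib
  have hprod : (lowPairs N K).card = Nat.primeCounting (N - 2 ^ K) * K := by
    rw [lowPairs, Finset.card_product, Nat.primesLE_card_eq_primeCounting, Nat.card_Icc]
    simp
  have : ((Nat.primeCounting (N - 2 ^ K) * K : ℕ) : ℝ) ≤ ((∑ n ∈ Finset.range (N + 1), romanovRep n : ℕ) : ℝ) := by
    exact_mod_cast hprod ▸ hsum
  push_cast at this
  linarith

/-! ### §2 Pintz 2006, Prop. 2 (lower half): `S₁(N) ≥ (1/log 2 − ε) N` -/

/-- `2^(log₂N − T) ≤ N` and `2^T · 2^(log₂N − T) ≤ N` once `T ≤ log₂ N`. [folklore] -/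
private theorem pow_log_sub_le {N T : ℕ} (hN : N ≠ 0) (hT : T ≤ Nat.log 2 N) :
    2 ^ T * 2 ^ (Nat.log 2 N - T) ≤ N := by
  rw [← pow_add, Nat.add_sub_cancel' hT]
  exact Nat.pow_log_le_self 2 hN

/-- `log₂ N > log N / log 2 − 1` (real form of `N < 2^(log₂N + 1)`). [folklore] -/
private theorem log_div_log_two_lt (N : ℕ) (hN : N ≠ 0) : Real.log N / Real.log 2 - 1 < (Nat.log 2 N : ℝ) := by
  have h := Nat.lt_pow_succ_log_self one_lt_two N
  have h' : (N : ℝ) < (2 : ℝ) ^ (Nat.log 2 N + 1) := by exact_mod_cast h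
  have hl2 : 0 < Real.log 2 := Real.log_pos one_lt_two
  have hNpos : (0 : ℝ) < N := by exact_mod_cast Nat.pos_of_ne_zero hN
  have hlog := Real.log_lt_log hNpos h'
  rw [Real.log_pow] at hlog
  push_cast at hlog
  rw [sub_lt_iff_lt_add, div_lt_iff₀ hl2]
  linarith

/-- **Pintz 2006, Proposition 2 (lower half): the first moment of `r`.**  For every `ε > 0`, eventually
`Σ_{n ≤ N} r(n) ≥ (1/log 2 − ε)·N` ("`S₁(N) ∼ N/log 2`": the prime number theorem summed over the `≈ log₂ N` exponents).
Proof: `K = ⌊log₂N⌋ − T` with `2^T ≥ 4/(ε log 2)`; `§1` gives `S₁ ≥ K·π(N − 2^K)` with `K ≥ log N/log 2 − (T+1)` and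
`N − 2^K ≥ (1 − 2^{-T})N`; the tree's prime number theorem at `N − 2^K`.  [cite: Pintz2006, Prop. 2]
[cite: JohnstonTrudgian2026, v2 §4.1 ("S₁(N) ∼ N/log 2")] -/
theorem pintz2006_prop2_lower {ε : ℝ} (hε : 0 < ε) :
    ∀ᶠ N : ℕ in atTop, (1 / Real.log 2 - ε) * N ≤ ∑ n ∈ Finset.range (N + 1), (romanovRep n : ℝ) := by
  have hl2 : 0 < Real.log 2 := Real.log_pos one_lt_two
  have hl21 : Real.log 2 < 1 := by have := Real.log_two_lt_d9; linarith
  -- η with 2η/log 2 ≤ ε/2 (η = ε log 2 / 6), capped at 1/2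
  set η : ℝ := min (1 / 2) (ε * Real.log 2 / 6) with hη_def
  have hη : 0 < η := lt_min (by norm_num) (by positivity)
  have hη1 : η ≤ 1 / 2 := min_le_left _ _
  have hηε : η ≤ ε * Real.log 2 / 6 := min_le_right _ _
  -- T ≥ 1 with 2^-T ≤ η
  obtain ⟨T₀, hT₀⟩ := pow_unbounded_of_one_lt (1 / η) (by norm_num : (1 : ℝ) < 2)
  set T : ℕ := T₀ + 1 with hTdef
  have hT1 : 1 ≤ T := by omega
  have h2T : (0 : ℝ) < (2 : ℝ) ^ T := by positivity
  have hT : 1 / η ≤ (2 : ℝ) ^ T := by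
    have : (2 : ℝ) ^ T₀ ≤ (2 : ℝ) ^ T := pow_le_pow_right₀ (by norm_num) (by omega)
    linarith
  have hηT : 1 / (2 : ℝ) ^ T ≤ η := by
    rw [div_le_iff₀ h2T]
    rw [div_le_iff₀ hη] at hT
    linarith
  have hP1 : 1 ≤ 2 ^ T := Nat.one_le_two_pow
  have hP2 : 2 ≤ 2 ^ T := by
    calc (2 : ℕ) = 2 ^ 1 := by norm_num
      _ ≤ 2 ^ T := Nat.pow_le_pow_right (by norm_num) hT1
  -- the prime number theorem, lower half, along m → ∞
  have hPNT : ∀ᶠ m : ℕ in atTop, (1 - η) * m / Real.log m ≤ Nat.primeCounting m := by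
    have h := tendsto_primeCounting_mul_log_div
    have hev : ∀ᶠ m : ℕ in atTop, 1 - η < (Nat.primeCounting m : ℝ) * Real.log m / m :=
      h.eventually (lt_mem_nhds (by linarith))
    filter_upwards [hev, eventually_ge_atTop 2] with m hm hm2
    have hm' : (2 : ℝ) ≤ m := by exact_mod_cast hm2
    have hlog : 0 < Real.log m := Real.log_pos (by linarith)
    have hmpos : (0 : ℝ) < m := by linarith
    rw [lt_div_iff₀ hmpos] at hm
    rw [div_le_iff₀ hlog]
    linarith
  -- transfer along m(N) = N − 2^(log₂N − T) → ∞  (m(N) ≥ N/2 since 2·2^(L−T) ≤ 2^T·2^(L−T) = 2^L ≤ N)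
  have hm_tendsto : Tendsto (fun N : ℕ => N - 2 ^ (Nat.log 2 N - T)) atTop atTop := by
    rw [tendsto_atTop_atTop]
    intro b
    refine ⟨2 * b + 2 ^ T, fun N hN => ?_⟩
    have hb : 2 * b ≤ N := le_trans (Nat.le_add_right _ _) hN
    have hPN : 2 ^ T ≤ N := le_trans (Nat.le_add_left _ _) hN
    have hN0 : N ≠ 0 := by
      intro h; rw [h] at hPN; exact absurd (le_antisymm hPN (Nat.zero_le _)) (by positivity)
    have hTle : T ≤ Nat.log 2 N := Nat.le_log_of_pow_le one_lt_two hPN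
    have hp := pow_log_sub_le hN0 hTle
    have h2 : 2 * 2 ^ (Nat.log 2 N - T) ≤ N :=
      le_trans (Nat.mul_le_mul_right _ hP2) hp
    generalize 2 ^ (Nat.log 2 N - T) = Q at h2 ⊢
    omega
  have hPNT' := hm_tendsto.eventually hPNT
  -- log N ≥ 2(T+1)/(ε log 2) eventually
  have hlogN : ∀ᶠ N : ℕ in atTop, 2 * (T + 1) / (ε * Real.log 2) ≤ Real.log (N : ℝ) :=
    (Real.tendsto_log_atTop.comp tendsto_natCast_atTop_atTop).eventually_ge_atTop _
  filter_upwards [hPNT', hlogN, eventually_ge_atTop (2 ^ T + 2)] with N hP hLN hN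
  -- notation and elementary facts
  have hPN : 2 ^ T ≤ N := by omega
  have hN0 : N ≠ 0 := by omega
  have hTle : T ≤ Nat.log 2 N := Nat.le_log_of_pow_le one_lt_two hPN
  set K : ℕ := Nat.log 2 N - T with hKdef
  have hpow := pow_log_sub_le hN0 hTle        -- 2^T * 2^K ≤ N
  have h2K : 2 ^ K ≤ N := le_trans (Nat.le_mul_of_pos_left _ (by positivity)) hpow
  set m : ℕ := N - 2 ^ K with hmdef
  have hX : (4 : ℝ) ≤ N := by exact_mod_cast (show 4 ≤ N by omega)
  have hNpos : (0 : ℝ) < N := by linarith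
  have hlogNpos : 0 < Real.log (N : ℝ) := Real.log_pos (by linarith)
  have hmR : (m : ℝ) = N - (2 : ℝ) ^ K := by
    rw [hmdef]; push_cast [Nat.cast_sub h2K]; ring
  have h2KR : (2 : ℝ) ^ K * (2 : ℝ) ^ T ≤ N := by
    have : (((2 ^ T * 2 ^ K : ℕ)) : ℝ) ≤ N := by exact_mod_cast hpow
    push_cast at this
    linarith
  -- 2^K ≤ η N  (from 2^K ≤ N/2^T and 1/2^T ≤ η)
  have h2Kη : (2 : ℝ) ^ K ≤ η * N := by
    have h1 : (2 : ℝ) ^ K ≤ (1 / (2 : ℝ) ^ T) * N := by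
      rw [one_div, ← div_eq_inv_mul, le_div_iff₀ h2T]
      exact h2KR
    have h2 : (1 / (2 : ℝ) ^ T) * N ≤ η * N := mul_le_mul_of_nonneg_right hηT hNpos.le
    linarith
  have hηN : η * N ≤ 1 / 2 * N := mul_le_mul_of_nonneg_right hη1 hNpos.le
  have hmge : (N : ℝ) - η * N ≤ m := by rw [hmR]; linarith
  have hmle : (m : ℝ) ≤ N := by
    rw [hmR]; linarith [pow_pos (show (0:ℝ) < 2 by norm_num) K]
  have hm1 : (1 : ℝ) < m := by linarith
  have hmpos : (0 : ℝ) < m := by linarith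
  have hlogm : 0 < Real.log (m : ℝ) := Real.log_pos hm1
  have hlogm_le : Real.log (m : ℝ) ≤ Real.log N := Real.log_le_log hmpos hmle
  -- K ≥ log N / log 2 − (T + 1)
  have hKR : Real.log N / Real.log 2 - (T + 1 : ℝ) ≤ K := by
    have h1 := log_div_log_two_lt N hN0
    have h2 : ((Nat.log 2 N : ℕ) : ℝ) = (K : ℝ) + T := by
      rw [hKdef]; push_cast [Nat.cast_sub hTle]; ring
    linarith
  have hKnn : (0 : ℝ) ≤ K := Nat.cast_nonneg K
  -- the pair count and the PNT at m
  have hS := card_pairs_le_sum_romanovRep h2K     -- K * π(m) ≤ S₁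
  have hPm : (1 - η) * m / Real.log m ≤ Nat.primeCounting m := hP
  -- π(m) ≥ (1-η) m / log m ≥ (1-η) m / log N ≥ (1-η)(N - ηN)/log N
  set Y : ℝ := (1 - η) * (N - η * N) / Real.log N with hYdef
  have hY0 : 0 ≤ Y := by
    apply div_nonneg _ hlogNpos.le
    exact mul_nonneg (by linarith) (by linarith)
  have hπ : Y ≤ Nat.primeCounting m := by
    have h0 : 0 ≤ (1 - η) * (m : ℝ) := mul_nonneg (by linarith) hmpos.le
    have h1 : Y ≤ (1 - η) * m / Real.log N := by
      apply div_le_div_of_nonneg_right _ hlogNpos.le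
      exact mul_le_mul_of_nonneg_left hmge (by linarith)
    have h2 : (1 - η) * m / Real.log N ≤ (1 - η) * m / Real.log m :=
      div_le_div_of_nonneg_left h0 hlogm hlogm_le
    linarith
  -- combine: S₁ ≥ K π(m) ≥ (log N/log 2 − (T+1)) · Y
  have hmain : (Real.log N / Real.log 2 - (T + 1 : ℝ)) * Y ≤ ∑ n ∈ Finset.range (N + 1), (romanovRep n : ℝ) :=
    calc (Real.log N / Real.log 2 - (T + 1 : ℝ)) * Y
        ≤ (K : ℝ) * Y := mul_le_mul_of_nonneg_right hKR hY0
      _ ≤ (K : ℝ) * Nat.primeCounting m := mul_le_mul_of_nonneg_left hπ hKnn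
      _ ≤ _ := hS
  -- the main term: (log N / log 2) · Y = (1-η)(N − ηN)/log 2
  have hlogY : Real.log N / Real.log 2 * Y = (1 - η) * (N - η * N) / Real.log 2 := by
    rw [hYdef, div_mul_div_comm, mul_comm (Real.log 2) (Real.log (N : ℝ)), mul_div_mul_left _ _ hlogNpos.ne']
  -- (1-η)(N − ηN)/log 2 ≥ N/log 2 − 2ηN/log 2 ≥ N/log 2 − (ε/2) N
  have hA : (N : ℝ) / Real.log 2 - ε / 2 * N ≤ (1 - η) * (N - η * N) / Real.log 2 := by
    have e1 : ((N : ℝ) - 2 * (η * N)) / Real.log 2 ≤ (1 - η) * (N - η * N) / Real.log 2 := by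
      apply div_le_div_of_nonneg_right _ hl2.le
      have i1 : (1 - η) * ((N : ℝ) - η * N) = N - 2 * (η * N) + η * (η * N) := by ring
      have i2 : 0 ≤ η * (η * (N : ℝ)) := mul_nonneg hη.le (mul_nonneg hη.le hNpos.le)
      linarith
    have e2 : ((N : ℝ) - 2 * (η * N)) / Real.log 2 = N / Real.log 2 - 2 * (η * N) / Real.log 2 := by ring
    have e3 : 2 * (η * N) / Real.log 2 ≤ ε / 2 * N := by
      rw [div_le_iff₀ hl2]
      have i1 : η * N ≤ ε * Real.log 2 / 6 * N := mul_le_mul_of_nonneg_right hηε hNpos.le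
      have i2 : ε / 2 * (N : ℝ) * Real.log 2 = 3 * (ε * Real.log 2 / 6 * N) := by ring
      have i3 : 0 ≤ ε * Real.log 2 / 6 * (N : ℝ) := by positivity
      linarith
    linarith
  -- the secondary term: (T+1) · Y ≤ (T+1) N / log N ≤ (ε/2) N
  have hB : (T + 1 : ℝ) * Y ≤ ε / 2 * N := by
    have f1 : Y ≤ N / Real.log N := by
      apply div_le_div_of_nonneg_right _ hlogNpos.le
      have i1 : (1 - η) * ((N : ℝ) - η * N) ≤ (N : ℝ) - η * N :=
        mul_le_of_le_one_left (by linarith) (by linarith)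
      have i2 : 0 ≤ η * (N : ℝ) := mul_nonneg hη.le hNpos.le
      linarith
    have f2 : (T + 1 : ℝ) * (N / Real.log N) ≤ ε / 2 * N := by
      rw [← mul_div_assoc, div_le_iff₀ hlogNpos]
      have g1 : 2 * (T + 1 : ℝ) ≤ Real.log N * (ε * Real.log 2) := (div_le_iff₀ (by positivity)).mp hLN
      have g2 : Real.log (N : ℝ) * (ε * Real.log 2) ≤ Real.log N * ε :=
        mul_le_mul_of_nonneg_left (mul_le_of_le_one_right hε.le hl21.le) hlogNpos.le
      have g3 : (T + 1 : ℝ) ≤ ε / 2 * Real.log N := by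
        have : Real.log (N : ℝ) * ε = 2 * (ε / 2 * Real.log N) := by ring
        linarith
      have g4 : (T + 1 : ℝ) * N ≤ (ε / 2 * Real.log N) * N := mul_le_mul_of_nonneg_right g3 hNpos.le
      have g5 : ε / 2 * (N : ℝ) * Real.log N = (ε / 2 * Real.log N) * N := by ring
      linarith
    have hT0 : (0 : ℝ) ≤ (T + 1 : ℝ) := by positivity
    calc (T + 1 : ℝ) * Y ≤ (T + 1 : ℝ) * (N / Real.log N) := mul_le_mul_of_nonneg_left f1 hT0
      _ ≤ ε / 2 * N := f2
  -- assemble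
  have e0 : (Real.log N / Real.log 2 - (T + 1 : ℝ)) * Y = Real.log N / Real.log 2 * Y - (T + 1 : ℝ) * Y := by ring
  have e5 : (1 / Real.log 2 - ε) * (N : ℝ) = N / Real.log 2 - ε / 2 * N - ε / 2 * N := by ring
  rw [e5]
  rw [e0, hlogY] at hmain
  linarith

/-! ### §3 The tree's Romanov frames with the first-moment row DISCHARGED -/

/-- **Romanov's constant by Pintz's method with only the sieve row assumed**: if `Σ_{n ≤ N} r(n)² ≤ (D/log 2 + ε)N`
eventually for every `ε > 0` (Pintz's Lemma 3′), then for every `k ≥ 1` and `ε > 0`, eventually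
`#romanovSet N ≥ ((2k + 1 − D)/(k(k+1) log 2) − ε)·N`.  (`eventually_card_romanovSet_ge` with `hr := romanovRep_pos_iff` and
`hS1 := pintz2006_prop2_lower`.) [cite: Pintz2006, Prop. 2, Lemma 3′, Lemma 4′] [cite: JohnstonTrudgian2026, v2 §4.1] -/
theorem eventually_card_romanovSet_ge_of_secondMoment {D : ℝ} {k : ℕ} (hk : 1 ≤ k)
    (hS2 : ∀ ε : ℝ, 0 < ε → ∀ᶠ N : ℕ in atTop,
      ∑ n ∈ Finset.range (N + 1), (romanovRep n : ℝ) ^ 2 ≤ (D / Real.log 2 + ε) * N) :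
    ∀ ε : ℝ, 0 < ε → ∀ᶠ N : ℕ in atTop,
      (((2 * k + 1) - D) / (k * (k + 1) * Real.log 2) - ε) * N ≤ ((romanovSet N).card : ℝ) :=
  eventually_card_romanovSet_ge romanovRep_pos_iff hk (fun _ hε => pintz2006_prop2_lower hε) hS2

/-- Cauchy–Schwarz version with only the sieve row assumed: eventually `#romanovSet N ≥ (1/(D log 2) − ε)·N`
(Romanov / Chen–Sun / Habsieger–Roblot deduction). [cite: ChenSun2004, proof of Thm 1] [cite: HabsiegerRoblot2006, §2]
[cite: Pintz2006, Prop. 2] -/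
theorem eventually_card_romanovSet_ge_cs_of_secondMoment {D : ℝ} (hD : 0 < D)
    (hS2 : ∀ ε : ℝ, 0 < ε → ∀ᶠ N : ℕ in atTop,
      ∑ n ∈ Finset.range (N + 1), (romanovRep n : ℝ) ^ 2 ≤ (D / Real.log 2 + ε) * N) :
    ∀ ε : ℝ, 0 < ε → ∀ᶠ N : ℕ in atTop, (1 / (D * Real.log 2) - ε) * N ≤ ((romanovSet N).card : ℝ) :=
  eventually_card_romanovSet_ge_cs romanovRep_pos_iff hD (fun _ hε => pintz2006_prop2_lower hε) hS2

/-- Pintz's "`K = 2`" observation with only the sieve row assumed: if `Σ r² ≤ (D/log 2 + ε)N` eventually and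
`(2k + 1 − D)/(k(k+1) log 2) > 1/4` for some `k ≥ 1`, then `goldbach_linnik_with 2`. [cite: Pintz2006, §1 and Prop. 2]
[cite: JohnstonTrudgian2026, v1 §4.2 (Proposition Pintzobs)] -/
theorem goldbach_linnik_two_of_secondMoment {D : ℝ} {k : ℕ} (hk : 1 ≤ k)
    (hval : 1 / 4 < ((2 * k + 1) - D) / (k * (k + 1) * Real.log 2))
    (hS2 : ∀ ε : ℝ, 0 < ε → ∀ᶠ N : ℕ in atTop,
      ∑ n ∈ Finset.range (N + 1), (romanovRep n : ℝ) ^ 2 ≤ (D / Real.log 2 + ε) * N) :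
    goldbach_linnik_with 2 :=
  goldbach_linnik_two_of_moments romanovRep_pos_iff hk hval (fun _ hε => pintz2006_prop2_lower hε) hS2

end RomanovConstant

end Literature.NumberTheory.Sieve
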